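import Summits.CriticalPhenomena.Ising3DConformalLimit.Theses.LatticeSDPCertificates
import Summits.CriticalPhenomena.Ising3DConformalLimit.Theorems.LatticeSDPCertificatesWindowBelowHalf
import Literature.Probability.LatticeModels.LatticeBootstrapFeasible
import Literature.Probability.LatticeModels.BoundaryLawFunctionalLevels
import Literature.Probability.LatticeModels.BoundaryLawFunctionalUniformLimit
import Literature.Probability.LatticeModels.PointwiseScalingLimitEtaExists
import Literature.Probability.LatticeModels.GHSTruncatedPair
import Literature.Probability.LatticeModels.GKSInequalities
import Literature.Probability.LatticeModels.PlusFreeComparison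
import Literature.Probability.LatticeModels.CriticalTwoPointBounds
import Literature.Probability.LatticeModels.MessagerMiracleSole
import HarnessLib

/-!
# Route `LatticeSDPCertificates`, crux `CertifiedWindow` (stmt-CriticalPhenomena-5504):
# the boundary half of the crux holds QUALITATIVELY — what is open is the rate

Helper file (`--supports stmt-CriticalPhenomena-5504`); nothing here proves or refutes the crux.
The crux `CertifiedWindow` (CW) is `R`-UNIFORM: constants `(ε, c)` and relative depth `k` must
serve every scale `R` and every row-feasible boundary law at level `kR`. Its registered skeleton
(`Cruxes/CertifiedWindow/Lines/birth.lean`, line `registered`) is closed modulo the bulk WINDOW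
(item `WindowBelowHalf`) and ONE boundary stub (one-scale-factor ratio stability of boundary-law
functionals against the bulk `G = criticalTwoPoint 3`, uniformly in `R`). This file records,
sorry-free, that the boundary stub HOLDS QUALITATIVELY — with the depth `k = k(R)` allowed to
depend on `R`, for ALL probability boundary laws, with no feasibility row at all — because the
critical Gibbs state on `ℤ³` is unique (`m*(β_c) = 0`, Aizenman–Duminil-Copin–Sidoravicius 2015;
Literature `boundaryLawFunctional_criticalBeta_pair_sub_criticalTwoPoint_uniform`: level-`L`
mixtures on a fixed pair converge to `G` uniformly in the law). Hence the ENTIRE open content of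
the boundary stub (and, given `WindowBelowHalf`, of CW) is a RATE in that uniqueness theorem:
boundedness of `k(R)` over row-feasible laws.

* `boundaryLaw_axis_twoSided` — `∀ R δ ∃ L₀ ∀ L ≥ L₀ ∀ ν`: `(1-δ)G(n e₁) ≤ E^ν_L{0,n e₁} ≤ (1+δ)G(n e₁)`, `n ≤ R`;
* `scaleStability_nonuniform` — the `ν`-form boundary stub with `k = k(R)` and constant `1+δ`;
* `window_at_depth_of_windowBelowHalf` — `WindowBelowHalf` ALONE gives CW's conclusion at every
  `R` with uniform `(ε, c)` and `k = k(R)` (conversely `CW → WindowBelowHalf` is landed,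
  `windowBelowHalf_of_certifiedWindow`);
* `boundaryLaw_pair_le_bulk_add_magnetization` — the upper side of boundary influence is at most
  the product of plus-box magnetisations (GHS), uniformly in the law: boundary laws can only LOWER
  pair values substantially; the open side is the lower one.

References: Friedli–Velenik 2017 (Lemma 3.23, Thm. 3.28, Exercise 3.31) [FriedliVelenik2017];
Aizenman–Duminil-Copin–Sidoravicius 2015, Thm. 1.2 [AizenmanDuminilCopinSidoraviciusCMP2015];
the reductions are elementary [folklore].
-/

noncomputable section

namespace Summit.CriticalPhenomena.Ising3DConformalLimit.Theorems

open Literature.Probability.LatticeModels MeasureTheory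
open Summit.CriticalPhenomena.Ising3DConformalLimit.Theses.LatticeSDPCertificates

/-- **Uniform two-sided comparability of the axis values with the bulk, at fixed scales.**
If box pair correlations converge to the critical two-point function uniformly in the boundary
law (Literature `boundaryLawFunctional_criticalBeta_pair_sub_criticalTwoPoint_uniform`, from
`m*(β_c) = 0`), so for every `R` and `δ > 0` there is a level `L₀` beyond which EVERY probability
boundary law `ν` has `(1-δ) G(n e₁) ≤ E^ν_L{0,n e₁} ≤ (1+δ) G(n e₁)` for all `1 ≤ n ≤ R`
(no feasibility rows are needed). [folklore] -/
theorem boundaryLaw_axis_twoSided (R : ℕ) {δ : ℝ} (hδ : 0 < δ) :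
    ∃ L₀ : ℕ, ∀ L : ℕ, L₀ ≤ L → ∀ (ν : Measure (SpinConfig (Site 3))) [IsProbabilityMeasure ν],
      ∀ n : ℕ, 1 ≤ n → n ≤ R →
        (1 - δ) * criticalTwoPoint 3 (Pi.single 0 (n : ℤ)) ≤
            boundaryLawFunctional 3 L (criticalBeta 3) ν {0, Pi.single 0 (n : ℤ)} ∧
          boundaryLawFunctional 3 L (criticalBeta 3) ν {0, Pi.single 0 (n : ℤ)} ≤
            (1 + δ) * criticalTwoPoint 3 (Pi.single 0 (n : ℤ)) := by
  induction R with
  | zero => exact ⟨0, fun L _ ν _ n hn hn0 => by omega⟩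
  | succ R ih =>
    obtain ⟨L₁, hL₁⟩ := ih
    have hG : 0 < criticalTwoPoint 3 (Pi.single 0 ((R + 1 : ℕ) : ℤ)) :=
      criticalTwoPoint_axis_pos (R + 1)
    obtain ⟨L₂, hL₂⟩ := boundaryLawFunctional_criticalBeta_pair_sub_criticalTwoPoint_uniform
      (single_natCast_ne_zero (n := R + 1) (by omega))
      (δ * criticalTwoPoint 3 (Pi.single 0 ((R + 1 : ℕ) : ℤ))) (mul_pos hδ hG)
    refine ⟨max L₁ L₂, fun L hL ν hν n hn hnR => ?_⟩
    rcases Nat.lt_or_ge n (R + 1) with hlt | hge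
    · exact hL₁ L (le_trans (le_max_left _ _) hL) ν n hn (by omega)
    · have hnR1 : n = R + 1 := le_antisymm hnR hge
      subst hnR1
      have h := hL₂ L (le_trans (le_max_right _ _) hL) ν
      rw [abs_le] at h
      constructor <;> nlinarith [h.1, h.2]

/-- **Qualitative boundary-law scale stability (the `ν`-form of the crux's boundary stub with the
relative depth allowed to depend on `R`).** For all `δ > 0`, `q ≥ 2` and `R` there is
`k ≥ 1` such that for all `L ≥ k R`, EVERY probability boundary law `ν` (feasible or not) and all
`n ≥ 1` with `q n ≤ R`: `G(q n e₁) E{0,n e₁} ≤ (1+δ) G(n e₁) E{0,q n e₁}`. The registered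
boundary stub of the crux asks for `k` INDEPENDENT of `R` (with a loss `K q^δ`); that uniformity —
a RATE in the uniqueness theorem at `β_c(3)`, uniformly over row-feasible boundary laws — is the
entire open content. [folklore] -/
theorem scaleStability_nonuniform' :
    ∀ δ : ℝ, 0 < δ → ∀ q : ℕ, 2 ≤ q → ∀ R : ℕ, ∃ k : ℕ, 1 ≤ k ∧
      ∀ (L : ℕ) (ν : Measure (SpinConfig (Site 3))), k * R ≤ L → IsProbabilityMeasure ν →
        ∀ n : ℕ, 1 ≤ n → q * n ≤ R →
          criticalTwoPoint 3 (Pi.single 0 ((q * n : ℕ) : ℤ)) *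
              boundaryLawFunctional 3 L (criticalBeta 3) ν {0, Pi.single 0 (n : ℤ)} ≤
            (1 + δ) * criticalTwoPoint 3 (Pi.single 0 (n : ℤ)) *
              boundaryLawFunctional 3 L (criticalBeta 3) ν {0, Pi.single 0 ((q * n : ℕ) : ℤ)} := by
  intro δ hδ q hq R
  -- `δ' := δ/(2+δ)` has `(1+δ')/(1-δ') = 1+δ`
  set δ' : ℝ := δ / (2 + δ) with hδ'
  have hδ'pos : 0 < δ' := div_pos hδ (by linarith)
  have hδ'lt : δ' < 1 := by rw [hδ', div_lt_one (by linarith)]; linarith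
  obtain ⟨L₀, hL₀⟩ := boundaryLaw_axis_twoSided R hδ'pos
  refine ⟨L₀ + 1, by omega, fun L ν hkR hν n hn hqn => ?_⟩
  haveI := hν
  have hR : 1 ≤ R := le_trans (le_trans hn (Nat.le_mul_of_pos_left n (by omega))) hqn
  have hL : L₀ ≤ L := by nlinarith
  have hqn1 : 1 ≤ q * n := Nat.mul_pos (by omega) hn
  obtain ⟨-, hEn⟩ := hL₀ L hL ν n hn (le_trans (Nat.le_mul_of_pos_left n (by omega)) hqn)
  obtain ⟨hEq, -⟩ := hL₀ L hL ν (q * n) hqn1 hqn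
  have hGn : 0 < criticalTwoPoint 3 (Pi.single 0 (n : ℤ)) := criticalTwoPoint_axis_pos n
  have hGq : 0 < criticalTwoPoint 3 (Pi.single 0 ((q * n : ℕ) : ℤ)) :=
    criticalTwoPoint_axis_pos (q * n)
  set Gn := criticalTwoPoint 3 (Pi.single 0 (n : ℤ))
  set Gq := criticalTwoPoint 3 (Pi.single 0 ((q * n : ℕ) : ℤ))
  set En := boundaryLawFunctional 3 L (criticalBeta 3) ν {0, Pi.single 0 (n : ℤ)}
  set Eq := boundaryLawFunctional 3 L (criticalBeta 3) ν {0, Pi.single 0 ((q * n : ℕ) : ℤ)}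
  -- `Gq En ≤ Gq (1+δ') Gn` and `(1-δ') Gq ≤ Eq`
  have h1 : Gq * En ≤ Gq * ((1 + δ') * Gn) := mul_le_mul_of_nonneg_left hEn hGq.le
  have hkey : (1 + δ') = (1 + δ) * (1 - δ') := by
    rw [hδ']; field_simp; ring
  calc Gq * En ≤ Gq * ((1 + δ') * Gn) := h1
    _ = (1 + δ) * Gn * ((1 - δ') * Gq) := by rw [hkey]; ring
    _ ≤ (1 + δ) * Gn * Eq := by
        apply mul_le_mul_of_nonneg_left hEq
        exact mul_nonneg (by linarith) hGn.le


/-- **Registered sub-goal `scaleStability_nonuniform` of item stmt-CriticalPhenomena-5504** (the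
qualitative, `k = k(R)` form of the crux's boundary stub; one line, fully qualified, verbatim the
registered signature): proof = `scaleStability_nonuniform'`. [folklore] -/
theorem scaleStability_nonuniform : ∀ δ : ℝ, 0 < δ → ∀ q : ℕ, 2 ≤ q → ∀ R : ℕ, ∃ k : ℕ, 1 ≤ k ∧ ∀ (L : ℕ) (ν : MeasureTheory.Measure (Literature.Probability.LatticeModels.SpinConfig (Literature.Probability.LatticeModels.Site 3))), k * R ≤ L → MeasureTheory.IsProbabilityMeasure ν → ∀ n : ℕ, 1 ≤ n → q * n ≤ R → Literature.Probability.LatticeModels.criticalTwoPoint 3 (Pi.single 0 ((q * n : ℕ) : ℤ)) * Literature.Probability.LatticeModels.boundaryLawFunctional 3 L (Literature.Probability.LatticeModels.criticalBeta 3) ν {0, Pi.single 0 (n : ℤ)} ≤ (1 + δ) * Literature.Probability.LatticeModels.criticalTwoPoint 3 (Pi.single 0 (n : ℤ)) * Literature.Probability.LatticeModels.boundaryLawFunctional 3 L (Literature.Probability.LatticeModels.criticalBeta 3) ν {0, Pi.single 0 ((q * n : ℕ) : ℤ)} :=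
  scaleStability_nonuniform'

/-- **Bulk WINDOW alone gives the conclusion of `CertifiedWindow` at every `R`, with `(ε, c)`
uniform and only the relative depth `k = k(R)` depending on `R`** (no feasibility rows
needed): if `WindowBelowHalf` holds with `(ε, c₁)` then with `c = c₁/3`, for every `R` there is
`k ≥ 1` such that every probability boundary law at level `L ≥ kR` obeys
`c (n/m)^{-(3/2-ε)} E{0,m e₁} ≤ E{0,n e₁}` for `1 ≤ m ≤ n ≤ R`. Since conversely
`CertifiedWindow → WindowBelowHalf` is landed (`windowBelowHalf_of_certifiedWindow` with
`criticalStateFeasible_proof`), the crux is `WindowBelowHalf` plus the boundedness of `k(R)` over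
row-feasible laws. [folklore] -/
theorem window_at_depth_of_windowBelowHalf (hW : WindowBelowHalf) :
    ∃ ε c : ℝ, 0 < ε ∧ 0 < c ∧ ∀ R : ℕ, ∃ k : ℕ, 1 ≤ k ∧
      ∀ (L : ℕ) (ν : Measure (SpinConfig (Site 3))), k * R ≤ L → IsProbabilityMeasure ν →
        ∀ m n : ℕ, 1 ≤ m → m ≤ n → n ≤ R →
          c * ((n : ℝ) / m) ^ (-((3:ℝ) / 2 - ε)) *
              boundaryLawFunctional 3 L (criticalBeta 3) ν {0, Pi.single 0 (m : ℤ)} ≤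
            boundaryLawFunctional 3 L (criticalBeta 3) ν {0, Pi.single 0 (n : ℤ)} := by
  obtain ⟨ε, c₁, hε, hc₁, hwin⟩ := hW
  refine ⟨ε, c₁ / 3, hε, by positivity, fun R => ?_⟩
  obtain ⟨L₀, hL₀⟩ := boundaryLaw_axis_twoSided R (δ := 1 / 2) (by norm_num)
  refine ⟨L₀ + 1, by omega, fun L ν hkR hν m n hm hmn hnR => ?_⟩
  haveI := hν
  have hL : L₀ ≤ L := by nlinarith [le_trans hm (le_trans hmn hnR)]
  obtain ⟨-, hEm⟩ := hL₀ L hL ν m hm (le_trans hmn hnR)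
  obtain ⟨hEn, -⟩ := hL₀ L hL ν n (le_trans hm hmn) hnR
  have hx : 0 ≤ ((n : ℝ) / m) ^ (-((3:ℝ) / 2 - ε)) := Real.rpow_nonneg (by positivity) _
  have hb := hwin m n hm hmn
  have hGm : 0 < criticalTwoPoint 3 (Pi.single 0 (m : ℤ)) := criticalTwoPoint_axis_pos m
  set x := ((n : ℝ) / m) ^ (-((3:ℝ) / 2 - ε))
  set Gm := criticalTwoPoint 3 (Pi.single 0 (m : ℤ))
  set Gn := criticalTwoPoint 3 (Pi.single 0 (n : ℤ))
  set Em := boundaryLawFunctional 3 L (criticalBeta 3) ν {0, Pi.single 0 (m : ℤ)}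
  set En := boundaryLawFunctional 3 L (criticalBeta 3) ν {0, Pi.single 0 (n : ℤ)}
  -- `Em ≤ (3/2) Gm`, `Gn/2 ≤ En`, `c₁ x Gm ≤ Gn`
  have h1 : c₁ / 3 * x * Em ≤ c₁ / 3 * x * ((1 + 1 / 2) * Gm) :=
    mul_le_mul_of_nonneg_left hEm (mul_nonneg (by positivity) hx)
  calc c₁ / 3 * x * Em ≤ c₁ / 3 * x * ((1 + 1 / 2) * Gm) := h1
    _ = (1 / 2) * (c₁ * x * Gm) := by ring
    _ ≤ (1 / 2) * Gn := by nlinarith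
    _ = (1 - 1 / 2) * Gn := by ring
    _ ≤ En := hEn

/-- **The upper half of boundary influence is the plus magnetisation squared (uniformly in the
boundary law).** For `x ≠ 0` with `x ∈ Λ_L` and every probability boundary law `ν`:
`E^ν_L{0,x} ≤ G(x) + ⟨σ_0⟩⁺_{Λ_L} ⟨σ_x⟩⁺_{Λ_L}` at `β_c(3)`. Chain: `E ≤ ⟨σ_0σ_x⟩⁺_{Λ_L}`
(Griffiths' comparison of boundary conditions), `⟨σ_0σ_x⟩⁺_Λ - ⟨σ_0⟩⁺_Λ⟨σ_x⟩⁺_Λ ≤ ⟨σ_0σ_x⟩^∅_Λ`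
(GHS / Lebowitz), `⟨σ_0σ_x⟩^∅_Λ ≤ ⟨σ_0σ_x⟩^∅ = ⟨σ_0σ_x⟩⁺ = G(x)` (GKS monotone limit and
`m*(β_c) = 0`). So boundary laws can RAISE a pair value above the bulk only by the product of
plus-box magnetisations (→ 0 with no known rate in `d = 3`); the open content of the crux's
boundary stub is the LOWER side. [cite: FriedliVelenik2017, Exercise 3.31 and Thm. 3.28] -/
theorem boundaryLaw_pair_le_bulk_add_magnetization {x : Site 3} (hx : x ≠ 0) {L : ℕ}
    (hxL : x ∈ box 3 L) (ν : Measure (SpinConfig (Site 3))) [IsProbabilityMeasure ν] :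
    boundaryLawFunctional 3 L (criticalBeta 3) ν {0, x} ≤
      criticalTwoPoint 3 x +
        isingCorr (zdGraph 3) (box 3 L) (criticalBeta 3) 0 .plus {0} *
          isingCorr (zdGraph 3) (box 3 L) (criticalBeta 3) 0 .plus {x} := by
  have hβ : 0 ≤ criticalBeta 3 := criticalBeta_nonneg 3
  have h0L : (0 : Site 3) ∈ box 3 L := by
    rw [mem_box]; intro i; simp
  have hA : ({0, x} : Finset (Site 3)) ⊆ box 3 L := by
    intro y hy
    simp only [Finset.mem_insert, Finset.mem_singleton] at hy
    rcases hy with rfl | rfl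
    · exact h0L
    · exact hxL
  have h1 : boundaryLawFunctional 3 L (criticalBeta 3) ν {0, x} ≤
      isingCorr (zdGraph 3) (box 3 L) (criticalBeta 3) 0 .plus {0, x} :=
    boundaryLawFunctional_le_isingCorr_plus hβ L ν hA
  have h2 := isingCorr_pair_trunc_plus_le_free (zdGraph 3) hβ h0L hxL (Ne.symm hx)
  have h3 : isingCorr (zdGraph 3) (box 3 L) (criticalBeta 3) 0 .free {0, x} ≤
      freeCorr 3 (criticalBeta 3) 0 {0, x} :=
    isingCorr_free_box_le_freeCorr hβ le_rfl hA
  have hm : spontaneousMagnetization 3 (criticalBeta 3) = 0 :=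
    spontaneousMagnetization_criticalBeta_eq_zero_holds (d := 3) le_rfl
  have h4 : freeCorr 3 (criticalBeta 3) 0 {0, x} = criticalTwoPoint 3 x := by
    rw [freeCorr_eq_plusCorr_of_spontaneousMagnetization_eq_zero hβ hm, criticalTwoPoint,
      twoPointPlus_eq_plusCorr_pair _ hx]
  linarith

end Summit.CriticalPhenomena.Ising3DConformalLimit.Theorems
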